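import Summits.QuantumFields.BalabanUV.Beta.D1BFx.FineHessianWardKronecker
import Summits.QuantumFields.BalabanUV.Beta.D1BFx.AssemblySlotsBal

/-!
# `BalabanUV.Beta.D1BFx.FineHessianWardKroneckerBlock` — road «BF-x» for binder row D1, sub-row «D1-BFx-KRONECKER-BLOCK»: THE A4 ∕ K-R5
# ENDs AT THE ROAD'S ENTRY `κ, λ ∈ {μ, ν}` FROM FIRST-BOND DIVERGENCE-FREENESS UNDER **BLOCK** COVARIANCE ONLY, AND SLOT (F) FOR THE
# GLUON PIECE OF RECORD WITH `hrow` + `hT1` RETIRED IN FAVOUR OF ONE DATUM `hdiv`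

HONEST DEPENDENCY (page 1, mandatory): continuum YM on T⁴ ⇐ BetaPertH ∧ nine spine estimates (0/9 proved); BetaPertH ⇐ (D1) ∧ (D4) ∧
CAP+tail; G-an2-4 gates asym, D1 and NE2/3/4.  HONEST FRAMING (cell contract, verbatim): «discharging `BetaPertH` makes Bałaban's UV
stability UNCONDITIONAL — a real constructive-QFT result; it is NOT the continuum limit and NOT the Clay problem.»  THIS MODULE DISCHARGES
NOTHING of D1 / BetaPertH: [folklore] bookkeeping BY NAME over leaf-02's `FineHessianWardKronecker` (the `wK`-dressed sandwich from Ward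
data), leaf-01's `ReducedKernelSandwichBlock` (the block-covariant sandwich identity) and the owner's `AssemblySlotsBal` (the slot-(F)
junction for Bałaban's R-weighted gluon piece).  First-bond divergence-freeness `hdiv` (equivalently the Ward laws (W1)∕(W2)) is a
HYPOTHESIS on the road's objects (whether Bałaban's jets satisfy it is nodes J ∕ K-R2 ∕ CHECK-N0 and leaf-01's N3-FINE-REL, NOT asserted).
No `def`, no `Prop` mirror, no cited fact, 0 sorry; 0 wall binders; NOT D1, NOT BetaPertH, NOT continuum, NOT Clay.

ABSOLUTE RULE (cell charter, verbatim): «No internally-minted statement may enter as a cited fact. Every hypothesis is either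
kernel-proved in this package or a verbatim quotation of a PUBLISHED theorem with page reference. The manuscript(s) under audit are NOT
citable for their own disputed steps — they are the thing under adjudication; programme-internal (2001/route/tribunal) claims are never
citable.»

WHY.  leaf-02's `FineHessianWardKronecker.bondSecondMoment_TOfLeg_eq_avgM2_of_divFree` removes K-R5's two analytic inputs `hrow` (Ward rows)
and `hT1` (base-point-summed first moments) at the road's entry `κ, λ ∈ {μ, ν}` in favour of ONE datum — first-bond divergence-freeness of
the fine Hessian kernel — but, like leaf-01's parts 1–2, it asks FINE translation covariance of the stencils ∕ tables (`S κ′ (u + v) =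
shiftK (−v) (S κ′ u)` for EVERY `v`).  Bałaban's R-weighted stencil `SbfBal` and table `Wbf` are only BLOCK-covariant
(`SbfBal_translate_block`, `Wbf_translate_block`: `v = n•t`), which is why the owner's junction `AssemblySlotsBal.hF_SbfBal` runs on the
block chain `ReducedKernelSandwichBlock.secondMoment_TOfLeg_eq_of_block` and still displays `hrow` + `hT1`.  This file is the block twin:
the proofs of the fine versions only ever used covariance at block vectors, so the same two lines go through with
`isBlockPeriodic_fineHessA_of_block` ∕ `TOfLeg_tableRedF_eq_dressedEntryP_of_block` in place of their fine-covariant specialisations.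

CONTENT (all [folklore]):
* §1 (any leg `A`, spread and block covariant; `S`∕`Wf` bi-localised, BLOCK-covariant, `Wf` bond-swap symmetric):
  **`bondSecondMoment_TOfLeg_eq_avgM2_of_divFree_of_block`** (`hdiv` ⟹ the K-R5 identity for `κ, λ ∈ {μ, ν}`),
  `secondMoment_TOfLeg_eq_of_divFree_of_block` (`B12Beta.secondMoment` currency), `bondSecondMoment_TOfLeg_eq_avgM2_of_wardLaws_of_block`
  ((W1)∕(W2) with a bi-localised generator `X` + block covariance ONLY).
* §2 (the slot-(F) junction, twins of `AssemblySlotsBal` BY NAME): `hF_TOfRed_of_divFree_of_block`, `hF_TOfRed_of_wardLaws_of_block`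
  (generic block-covariant `S`, `Wf` over the gluon leg `Ga n a`), **`hF_SbfBal_of_divFree`**, **`hF_SbfBal_of_wardLaws`** (the gluon piece
  of record: displayed inputs `1 ≤ n`, `0 < a`, `Spr (Ga n a)`, the five slot tables bi-localised at one rate ∕ block-covariant ∕ bond-swap
  symmetric, and EITHER `hdiv` of `fineHess n a SbfBal Wbf` OR a bi-localised generator `X` with (W1)∕(W2) — `hrow` AND `hT1` both gone).
Unit `b2b-balaban-gan24-formalise-leaf-05` (gen 31; cross-lane, owner's claimable sub-row of journal l.15304).
-/

noncomputable section

namespace Summit.QuantumFields.BalabanUV.Beta.D1BFx.FineHessianWardKroneckerBlock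

open Finset Filter Topology
open scoped BigOperators
open Literature.MathematicalPhysics.QuantumFieldTheory.Balaban1983to89
open Literature.MathematicalPhysics.QuantumFieldTheory.Balaban1983to89.Beta
open WindowIdentification (fullSum)
open DyadicShell (Pt toReal)
open ExpKernelCalculus (Site MKer BiLoc comp shiftK)
open DressedMomentNormalisation (resSite)
open KernelWard (divV divW)
open Summit.QuantumFields.BalabanUV.Beta.TameKernelCalculus (Spr biLoc_of_le)
open Summit.QuantumFields.BalabanUV.Beta.D1BFx.ReducedKernelF (TOfLeg)
open Summit.QuantumFields.BalabanUV.Beta.D1BFx.ReducedTableF (tableRedF)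
open Summit.QuantumFields.BalabanUV.Beta.D1BFx.MomentTransferPeriodic (baseKer)
open Summit.QuantumFields.BalabanUV.Beta.D1BFx.MomentTransferPeriodicEntry (avgM2)
open Summit.QuantumFields.BalabanUV.Beta.D1BFx.ReducedKernelSandwichLeg (fineHessA absMoment₂_baseKer_fineHessA fineHessA_transpose
  fineHessA_Ga)
open Summit.QuantumFields.BalabanUV.Beta.D1BFx.ReducedKernelSandwichBlock (isBlockPeriodic_fineHessA_of_block
  TOfLeg_tableRedF_eq_dressedEntryP_of_block)
open Summit.QuantumFields.BalabanUV.Beta.D1BFx.FineHessianWard (divFree_fineHessA_of_wardLaws)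
open Summit.QuantumFields.BalabanUV.Beta.D1BFx.FineHessianWardKronecker (bondSecondMomentP_solutionOp_four_of_divFree)
open Summit.QuantumFields.BalabanUV.Beta.FP.PerfectColumnKronecker (divFree_single_of_unitVec)
open Summit.QuantumFields.BalabanUV.Beta.D1BFx.GluonLeg (Ga shiftK_Ga_neg)
open Summit.QuantumFields.BalabanUV.Beta.D1BFx.ReducedKernel (StencilR TableR TOfRed)
open Summit.QuantumFields.BalabanUV.Beta.D1BFx.DressedTadpoleTable (Table₂R tableRed)
open Summit.QuantumFields.BalabanUV.Beta.D1BFx.ReducedKernelSandwich (fineHess absMoment₂_baseKer_fineHess)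
open Summit.QuantumFields.BalabanUV.Beta.D1BFx.ReducedTableBridge (TOfLeg_tableRedF_eq_TOfRed_tableRed)
open Summit.QuantumFields.BalabanUV.Beta.D1BFx.FineStencilBFBalaban (SbfBal exists_biLoc_SbfBal SbfBal_translate_block)
open Summit.QuantumFields.BalabanUV.Beta.D1BFx.SecondStencilBF (Wbf biLoc_Wbf Wbf_symm Wbf_translate_block)
open Summit.QuantumFields.BalabanUV.Beta.D1BFx.AssemblySlots (secondMoment_eq_avg_fullSum)

/-! ## §1 A4 ∕ K-R5 over any leg at the road's entry: divergence-freeness in, BLOCK covariance only -/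

section Leg

variable {F : Type*} [Fintype F] [Nonempty F] (n : ℕ) [NeZero n]
variable (A : MKer 4 F) {S : Fin 4 → Site 4 → MKer 4 F} {Wf : Fin 4 → Site 4 → Fin 4 → Site 4 → MKer 4 F} {Cs C2 Cx δ : ℝ}

/-- [folklore] **A4 OVER ANY LEG AT THE ENTRIES `κ, λ ∈ {μ, ν}` — FIRST-BOND DIVERGENCE-FREENESS IN, BLOCK COVARIANCE ONLY.**  Leg `A`
spread and block covariant; `S` self-localised and BLOCK-translation covariant (`u ↦ u + n•t`); `Wf` bi-localised, jointly block covariant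
and SYMMETRIC; GIVEN that `fineHessA A S Wf` is divergence-free in the first bond:
`Σ'_z z_κ z_λ · n⁸ · TOfLeg n A S (tableRedF n Wf) μ ν z = avgM2 n (fineHessA A S Wf μ ν) κ λ` for `κ, λ ∈ {μ, ν}` — leaf-02's
`FineHessianWardKronecker.bondSecondMoment_TOfLeg_eq_avgM2_of_divFree` with `hScov`∕`hWcov` weakened to block vectors (equivalently leaf-01's
`ReducedKernelSandwichBlock.bondSecondMoment_TOfLeg_eq_avgM2_of_block` restricted to the entries `κ, λ ∈ {μ, ν}`, with `hrow` + `hT1` ↦ `hdiv`). -/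
theorem bondSecondMoment_TOfLeg_eq_avgM2_of_divFree_of_block (hA : Spr A) (hAcov : ∀ t : Site 4, shiftK (-((n : ℤ) • t)) A = A)
    (hS : ∀ κ' u, BiLoc (S κ' u) u u Cs δ) (hW : ∀ κ' u l' u', BiLoc (Wf κ' u l' u') u u' C2 δ) (hδ : 0 < δ)
    (hScov : ∀ (κ' : Fin 4) (u t : Site 4), S κ' (u + (n : ℤ) • t) = shiftK (-((n : ℤ) • t)) (S κ' u))
    (hWcov : ∀ (κ' : Fin 4) (u : Site 4) (l' : Fin 4) (u' t : Site 4),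
      Wf κ' (u + (n : ℤ) • t) l' (u' + (n : ℤ) • t) = shiftK (-((n : ℤ) • t)) (Wf κ' u l' u'))
    (hWsymm : ∀ (κ' : Fin 4) (u : Site 4) (l' : Fin 4) (u' : Site 4), Wf κ' u l' u' = Wf l' u' κ' u)
    (hdiv : ∀ (l' : Fin 4) (u' u : Site 4),
      ∑ κ' : Fin 4, (fineHessA A S Wf κ' l' (u - Pi.single κ' 1) u' - fineHessA A S Wf κ' l' u u') = 0)
    {κ lam μ ν : Fin 4} (hκ : κ = μ ∨ κ = ν) (hlam : lam = μ ∨ lam = ν) :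
    ∑' z : Site 4, ((z κ * z lam : ℤ) : ℝ) * ((n : ℝ) ^ 8 * TOfLeg n A S (tableRedF n Wf) μ ν z)
      = avgM2 n (fineHessA A S Wf μ ν) κ lam := by
  have h := bondSecondMomentP_solutionOp_four_of_divFree (N := n) (fineHessA A S Wf)
    (isBlockPeriodic_fineHessA_of_block n A hAcov hScov hWcov)
    (fun c e s s' => fineHessA_transpose A hA hS hδ hWsymm c e s s') hdiv (absMoment₂_baseKer_fineHessA A hA hS hW hδ) hκ hlam
  rw [← h, ← (Equiv.neg (Site 4)).tsum_eq]
  refine tsum_congr fun z => ?_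
  rw [TOfLeg_tableRedF_eq_dressedEntryP_of_block n A hA hAcov hS hW hδ hScov hWcov μ ν]
  simp only [Equiv.neg_apply, Pi.neg_apply, neg_mul_neg, neg_neg]

/-- [folklore] The same in `B12Beta.secondMoment` currency (`ReducedKernelSandwichBlock.secondMoment_TOfLeg_eq_of_block` with `hrow` + `hT1`
↦ `hdiv`; entries `κ, λ ∈ {μ, ν}`). -/
theorem secondMoment_TOfLeg_eq_of_divFree_of_block (hA : Spr A) (hAcov : ∀ t : Site 4, shiftK (-((n : ℤ) • t)) A = A)
    (hS : ∀ κ' u, BiLoc (S κ' u) u u Cs δ) (hW : ∀ κ' u l' u', BiLoc (Wf κ' u l' u') u u' C2 δ) (hδ : 0 < δ)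
    (hScov : ∀ (κ' : Fin 4) (u t : Site 4), S κ' (u + (n : ℤ) • t) = shiftK (-((n : ℤ) • t)) (S κ' u))
    (hWcov : ∀ (κ' : Fin 4) (u : Site 4) (l' : Fin 4) (u' t : Site 4),
      Wf κ' (u + (n : ℤ) • t) l' (u' + (n : ℤ) • t) = shiftK (-((n : ℤ) • t)) (Wf κ' u l' u'))
    (hWsymm : ∀ (κ' : Fin 4) (u : Site 4) (l' : Fin 4) (u' : Site 4), Wf κ' u l' u' = Wf l' u' κ' u)
    (hdiv : ∀ (l' : Fin 4) (u' u : Site 4),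
      ∑ κ' : Fin 4, (fineHessA A S Wf κ' l' (u - Pi.single κ' 1) u' - fineHessA A S Wf κ' l' u u') = 0)
    {κ lam μ ν : Fin 4} (hκ : κ = μ ∨ κ = ν) (hlam : lam = μ ∨ lam = ν) :
    ∑' z : Site 4, TOfLeg n A S (tableRedF n Wf) μ ν z * (z κ : ℝ) * (z lam : ℝ)
      = ((n : ℝ) ^ 8)⁻¹ * avgM2 n (fineHessA A S Wf μ ν) κ lam := by
  have hn' : (n : ℝ) ^ 8 ≠ 0 := pow_ne_zero 8 (by exact_mod_cast NeZero.ne n)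
  have h := bondSecondMoment_TOfLeg_eq_avgM2_of_divFree_of_block n A hA hAcov hS hW hδ hScov hWcov hWsymm hdiv hκ hlam
  have e : (fun z : Site 4 => ((z κ * z lam : ℤ) : ℝ) * ((n : ℝ) ^ 8 * TOfLeg n A S (tableRedF n Wf) μ ν z))
      = fun z => (n : ℝ) ^ 8 * (TOfLeg n A S (tableRedF n Wf) μ ν z * (z κ : ℝ) * (z lam : ℝ)) := by
    funext z
    push_cast
    ring
  rw [e, tsum_mul_left] at h
  rw [← h, ← mul_assoc, inv_mul_cancel₀ hn', one_mul]

/-- [folklore] **A4 ∕ K-R5 OVER ANY LEG FROM THE WARD LAWS ONLY, BLOCK-COVARIANT DATA**: leg spread and block covariant; stencils ∕ tables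
bi-localised, BLOCK covariant, table symmetric; a bi-localised gauge generator `X` with (W1) `(A ∘ divV S u) ∘ A = A ∘ X u − X u ∘ A` and
(W2) `divW Wf u λ′ u′ = X u ∘ S λ′ u′ − S λ′ u′ ∘ X u` ⟹ the K-R5 identity at `κ, λ ∈ {μ, ν}` (leaf-02's
`bondSecondMoment_TOfLeg_eq_avgM2_of_wardLaws'` with block covariance; via leaf-01's `divFree_fineHessA_of_wardLaws`). -/
theorem bondSecondMoment_TOfLeg_eq_avgM2_of_wardLaws_of_block (hA : Spr A) (hAcov : ∀ t : Site 4, shiftK (-((n : ℤ) • t)) A = A)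
    (hS : ∀ κ' u, BiLoc (S κ' u) u u Cs δ) (hW : ∀ κ' u l' u', BiLoc (Wf κ' u l' u') u u' C2 δ) (hδ : 0 < δ)
    (hScov : ∀ (κ' : Fin 4) (u t : Site 4), S κ' (u + (n : ℤ) • t) = shiftK (-((n : ℤ) • t)) (S κ' u))
    (hWcov : ∀ (κ' : Fin 4) (u : Site 4) (l' : Fin 4) (u' t : Site 4),
      Wf κ' (u + (n : ℤ) • t) l' (u' + (n : ℤ) • t) = shiftK (-((n : ℤ) • t)) (Wf κ' u l' u'))
    (hWsymm : ∀ (κ' : Fin 4) (u : Site 4) (l' : Fin 4) (u' : Site 4), Wf κ' u l' u' = Wf l' u' κ' u)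
    (X : Site 4 → MKer 4 F) (hX : ∀ u, BiLoc (X u) u u Cx δ)
    (hW1 : ∀ u, comp (comp A (divV S u)) A = comp A (X u) - comp (X u) A)
    (hW2 : ∀ (u : Site 4) (l' : Fin 4) (u' : Site 4), divW Wf u l' u' = comp (X u) (S l' u') - comp (S l' u') (X u))
    {κ lam μ ν : Fin 4} (hκ : κ = μ ∨ κ = ν) (hlam : lam = μ ∨ lam = ν) :
    ∑' z : Site 4, ((z κ * z lam : ℤ) : ℝ) * ((n : ℝ) ^ 8 * TOfLeg n A S (tableRedF n Wf) μ ν z)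
      = avgM2 n (fineHessA A S Wf μ ν) κ lam :=
  bondSecondMoment_TOfLeg_eq_avgM2_of_divFree_of_block n A hA hAcov hS hW hδ hScov hWcov hWsymm
    (divFree_single_of_unitVec (divFree_fineHessA_of_wardLaws A X hA hS hW hX hδ hW1 hW2)) hκ hlam

end Leg

/-! ## §2 Slot (F) for the reduced gluon kernel under BLOCK covariance, `hrow` + `hT1` ↦ `hdiv` -/

section Block

variable (n : ℕ) [NeZero n] (a : ℝ) {S : StencilR} {Wf : Table₂R} {Cs C2 Cx δ : ℝ}

/-- [folklore] **SLOT (F) FOR `TOfRed n a S (tableRed n Wf)` UNDER BLOCK COVARIANCE FROM FIRST-BOND DIVERGENCE-FREENESS**: the owner's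
`AssemblySlotsBal.hF_TOfRed_of_block` with its two analytic inputs `hrow` (Ward rows) and `hT1` (base-point-summed first moments of
`fineHess n a S Wf`) REPLACED by the single datum `hdiv` (first-bond divergence-freeness of `fineHess n a S Wf`). -/
theorem hF_TOfRed_of_divFree_of_block (hn : 1 ≤ n) (hGa : Spr (Ga n a)) (hS : ∀ κ' u, BiLoc (S κ' u) u u Cs δ)
    (hW : ∀ κ' u l' u', BiLoc (Wf κ' u l' u') u u' C2 δ) (hδ : 0 < δ)
    (hScov : ∀ (κ' : Fin 4) (u t : Site 4), S κ' (u + (n : ℤ) • t) = shiftK (-((n : ℤ) • t)) (S κ' u))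
    (hWcov : ∀ (κ' : Fin 4) (u : Site 4) (l' : Fin 4) (u' t : Site 4),
      Wf κ' (u + (n : ℤ) • t) l' (u' + (n : ℤ) • t) = shiftK (-((n : ℤ) • t)) (Wf κ' u l' u'))
    (hWsymm : ∀ (κ' : Fin 4) (u : Site 4) (l' : Fin 4) (u' : Site 4), Wf κ' u l' u' = Wf l' u' κ' u)
    (hdiv : ∀ (l' : Fin 4) (u' u : Site 4),
      ∑ κ' : Fin 4, (fineHess n a S Wf κ' l' (u - Pi.single κ' 1) u' - fineHess n a S Wf κ' l' u u') = 0)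
    (μ ν : Fin 4) :
    B12Beta.secondMoment (TOfRed n a S (tableRed n Wf)) μ ν =
      ∑ b ∈ (univ : Finset (Fin 4 → Fin n)).image resSite, ((n : ℝ) ^ 4)⁻¹ *
        fullSum (fun w : Pt => ((n : ℝ) ^ 8)⁻¹ * (toReal w μ * toReal w ν * baseKer (fineHess n a S Wf μ ν) b w)) := by
  refine secondMoment_eq_avg_fullSum ?_ fun r => absMoment₂_baseKer_fineHess n a hGa hS hW hδ μ ν (resSite r)
  have h := secondMoment_TOfLeg_eq_of_divFree_of_block n (Ga n a) hGa (shiftK_Ga_neg n a hn) hS hW hδ hScov hWcov hWsymm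
    (by rw [fineHessA_Ga]; exact hdiv) (κ := μ) (lam := ν) (μ := μ) (ν := ν) (Or.inl rfl) (Or.inr rfl)
  rw [TOfLeg_tableRedF_eq_TOfRed_tableRed n a S hW hδ, fineHessA_Ga] at h
  exact h

/-- [folklore] **SLOT (F) FOR `TOfRed n a S (tableRed n Wf)` UNDER BLOCK COVARIANCE FROM THE WARD LAWS**: as `hF_TOfRed_of_divFree_of_block`
with `hdiv` supplied by a bi-localised gauge generator `X` satisfying (W1) against the gluon leg `Ga n a` and (W2) for the table. -/
theorem hF_TOfRed_of_wardLaws_of_block (hn : 1 ≤ n) (hGa : Spr (Ga n a)) (hS : ∀ κ' u, BiLoc (S κ' u) u u Cs δ)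
    (hW : ∀ κ' u l' u', BiLoc (Wf κ' u l' u') u u' C2 δ) (hδ : 0 < δ)
    (hScov : ∀ (κ' : Fin 4) (u t : Site 4), S κ' (u + (n : ℤ) • t) = shiftK (-((n : ℤ) • t)) (S κ' u))
    (hWcov : ∀ (κ' : Fin 4) (u : Site 4) (l' : Fin 4) (u' t : Site 4),
      Wf κ' (u + (n : ℤ) • t) l' (u' + (n : ℤ) • t) = shiftK (-((n : ℤ) • t)) (Wf κ' u l' u'))
    (hWsymm : ∀ (κ' : Fin 4) (u : Site 4) (l' : Fin 4) (u' : Site 4), Wf κ' u l' u' = Wf l' u' κ' u)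
    (X : Site 4 → MKer 4 (Fin 4)) (hX : ∀ u, BiLoc (X u) u u Cx δ)
    (hW1 : ∀ u, comp (comp (Ga n a) (divV S u)) (Ga n a) = comp (Ga n a) (X u) - comp (X u) (Ga n a))
    (hW2 : ∀ (u : Site 4) (l' : Fin 4) (u' : Site 4), divW Wf u l' u' = comp (X u) (S l' u') - comp (S l' u') (X u))
    (μ ν : Fin 4) :
    B12Beta.secondMoment (TOfRed n a S (tableRed n Wf)) μ ν =
      ∑ b ∈ (univ : Finset (Fin 4 → Fin n)).image resSite, ((n : ℝ) ^ 4)⁻¹ *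
        fullSum (fun w : Pt => ((n : ℝ) ^ 8)⁻¹ * (toReal w μ * toReal w ν * baseKer (fineHess n a S Wf μ ν) b w)) :=
  hF_TOfRed_of_divFree_of_block n a hn hGa hS hW hδ hScov hWcov hWsymm
    (by
      rw [← fineHessA_Ga]
      exact divFree_single_of_unitVec (divFree_fineHessA_of_wardLaws (Ga n a) X hGa hS hW hX hδ hW1 hW2)) μ ν

end Block

/-! ## §3 Slot (F) for Bałaban's R-weighted gluon piece `TOfRed n a SbfBal (tableRed n Wbf)`, `hrow` + `hT1` ↦ `hdiv` -/

section Bal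

variable (n : ℕ) [NeZero n] (a cE cVH cΛ cR cK cQ cE₂ cJ4 cΛ₂ cR₂ cQ₂ : ℝ) {WE WJ WΛ WR WQ : TableR} {CE CJ CΛ CR CQ Cx δW : ℝ}

/-- [folklore] **SLOT (F) FOR THE GLUON PIECE OF RECORD FROM FIRST-BOND DIVERGENCE-FREENESS** —
`TOfRed n a (SbfBal n a cE cVH cΛ cR cK cQ) (tableRed n (Wbf cE₂ cJ4 cΛ₂ cR₂ cQ₂ WE WJ WΛ WR WQ))`: the owner's `AssemblySlotsBal.hF_SbfBal` with
K-R5's two analytic inputs `hrow` + `hT1` REPLACED by ONE datum, first-bond divergence-freeness `hdiv` of `fineHess n a SbfBal Wbf`.  Displayed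
inputs: `1 ≤ n`, `0 < a`, the leg binder `Spr (Ga n a)`, the five slot tables bi-localised at one common rate `δW > 0`, block-covariant
(negative convention) and bond-swap symmetric, and `hdiv`. -/
theorem hF_SbfBal_of_divFree (hn : 1 ≤ n) (ha : 0 < a) (hGa : Spr (Ga n a)) (hδW : 0 < δW)
    (hE : ∀ κ u l u', BiLoc (WE κ u l u') u u' CE δW) (hJ : ∀ κ u l u', BiLoc (WJ κ u l u') u u' CJ δW)
    (hΛ : ∀ κ u l u', BiLoc (WΛ κ u l u') u u' CΛ δW) (hR : ∀ κ u l u', BiLoc (WR κ u l u') u u' CR δW)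
    (hQ : ∀ κ u l u', BiLoc (WQ κ u l u') u u' CQ δW)
    (hEc : ∀ (κ : Fin 4) (u : Site 4) (l : Fin 4) (u' t : Site 4),
      WE κ (u + (n : ℤ) • t) l (u' + (n : ℤ) • t) = shiftK (-((n : ℤ) • t)) (WE κ u l u'))
    (hJc : ∀ (κ : Fin 4) (u : Site 4) (l : Fin 4) (u' t : Site 4),
      WJ κ (u + (n : ℤ) • t) l (u' + (n : ℤ) • t) = shiftK (-((n : ℤ) • t)) (WJ κ u l u'))
    (hΛc : ∀ (κ : Fin 4) (u : Site 4) (l : Fin 4) (u' t : Site 4),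
      WΛ κ (u + (n : ℤ) • t) l (u' + (n : ℤ) • t) = shiftK (-((n : ℤ) • t)) (WΛ κ u l u'))
    (hRc : ∀ (κ : Fin 4) (u : Site 4) (l : Fin 4) (u' t : Site 4),
      WR κ (u + (n : ℤ) • t) l (u' + (n : ℤ) • t) = shiftK (-((n : ℤ) • t)) (WR κ u l u'))
    (hQc : ∀ (κ : Fin 4) (u : Site 4) (l : Fin 4) (u' t : Site 4),
      WQ κ (u + (n : ℤ) • t) l (u' + (n : ℤ) • t) = shiftK (-((n : ℤ) • t)) (WQ κ u l u'))
    (hEs : ∀ κ u l u', WE κ u l u' = WE l u' κ u) (hJs : ∀ κ u l u', WJ κ u l u' = WJ l u' κ u)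
    (hΛs : ∀ κ u l u', WΛ κ u l u' = WΛ l u' κ u) (hRs : ∀ κ u l u', WR κ u l u' = WR l u' κ u)
    (hQs : ∀ κ u l u', WQ κ u l u' = WQ l u' κ u)
    (hdiv : ∀ (l' : Fin 4) (u' u : Site 4), ∑ κ' : Fin 4,
      (fineHess n a (SbfBal n a cE cVH cΛ cR cK cQ) (Wbf cE₂ cJ4 cΛ₂ cR₂ cQ₂ WE WJ WΛ WR WQ) κ' l' (u - Pi.single κ' 1) u'
        - fineHess n a (SbfBal n a cE cVH cΛ cR cK cQ) (Wbf cE₂ cJ4 cΛ₂ cR₂ cQ₂ WE WJ WΛ WR WQ) κ' l' u u') = 0)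
    (μ ν : Fin 4) :
    B12Beta.secondMoment (TOfRed n a (SbfBal n a cE cVH cΛ cR cK cQ) (tableRed n (Wbf cE₂ cJ4 cΛ₂ cR₂ cQ₂ WE WJ WΛ WR WQ))) μ ν =
      ∑ b ∈ (univ : Finset (Fin 4 → Fin n)).image resSite, ((n : ℝ) ^ 4)⁻¹ *
        fullSum (fun w : Pt => ((n : ℝ) ^ 8)⁻¹ * (toReal w μ * toReal w ν *
          baseKer (fineHess n a (SbfBal n a cE cVH cΛ cR cK cQ) (Wbf cE₂ cJ4 cΛ₂ cR₂ cQ₂ WE WJ WΛ WR WQ) μ ν) b w)) := by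
  obtain ⟨Cs, δS, hδS, hS⟩ := exists_biLoc_SbfBal n a ha cE cVH cΛ cR cK cQ
  have hW := biLoc_Wbf (cE₂ := cE₂) (cJ4 := cJ4) (cΛ₂ := cΛ₂) (cR₂ := cR₂) (cQ₂ := cQ₂) hE hJ hΛ hR hQ
  exact hF_TOfRed_of_divFree_of_block n a hn hGa (fun κ' u => biLoc_of_le (hS κ' u) (min_le_left δS δW))
    (fun κ' u l' u' => biLoc_of_le (hW κ' u l' u') (min_le_right δS δW)) (lt_min hδS hδW)
    (SbfBal_translate_block n a ha cE cVH cΛ cR cK cQ) (Wbf_translate_block hEc hJc hΛc hRc hQc) (Wbf_symm hEs hJs hΛs hRs hQs)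
    hdiv μ ν

/-- [folklore] **SLOT (F) FOR THE GLUON PIECE OF RECORD FROM THE WARD LAWS** — as `hF_SbfBal_of_divFree` with `hdiv` supplied by a gauge
generator `X u` bi-localised at `(u, u)` (any rate `δX > 0`) satisfying (W1) `(Ga ∘ divV SbfBal u) ∘ Ga = Ga ∘ X u − X u ∘ Ga` and
(W2) `divW Wbf u λ′ u′ = X u ∘ SbfBal λ′ u′ − SbfBal λ′ u′ ∘ X u`.  Whether Bałaban's jets satisfy (W1)∕(W2) is NOT asserted here. -/
theorem hF_SbfBal_of_wardLaws (hn : 1 ≤ n) (ha : 0 < a) (hGa : Spr (Ga n a)) (hδW : 0 < δW)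
    (hE : ∀ κ u l u', BiLoc (WE κ u l u') u u' CE δW) (hJ : ∀ κ u l u', BiLoc (WJ κ u l u') u u' CJ δW)
    (hΛ : ∀ κ u l u', BiLoc (WΛ κ u l u') u u' CΛ δW) (hR : ∀ κ u l u', BiLoc (WR κ u l u') u u' CR δW)
    (hQ : ∀ κ u l u', BiLoc (WQ κ u l u') u u' CQ δW)
    (hEc : ∀ (κ : Fin 4) (u : Site 4) (l : Fin 4) (u' t : Site 4),
      WE κ (u + (n : ℤ) • t) l (u' + (n : ℤ) • t) = shiftK (-((n : ℤ) • t)) (WE κ u l u'))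
    (hJc : ∀ (κ : Fin 4) (u : Site 4) (l : Fin 4) (u' t : Site 4),
      WJ κ (u + (n : ℤ) • t) l (u' + (n : ℤ) • t) = shiftK (-((n : ℤ) • t)) (WJ κ u l u'))
    (hΛc : ∀ (κ : Fin 4) (u : Site 4) (l : Fin 4) (u' t : Site 4),
      WΛ κ (u + (n : ℤ) • t) l (u' + (n : ℤ) • t) = shiftK (-((n : ℤ) • t)) (WΛ κ u l u'))
    (hRc : ∀ (κ : Fin 4) (u : Site 4) (l : Fin 4) (u' t : Site 4),
      WR κ (u + (n : ℤ) • t) l (u' + (n : ℤ) • t) = shiftK (-((n : ℤ) • t)) (WR κ u l u'))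
    (hQc : ∀ (κ : Fin 4) (u : Site 4) (l : Fin 4) (u' t : Site 4),
      WQ κ (u + (n : ℤ) • t) l (u' + (n : ℤ) • t) = shiftK (-((n : ℤ) • t)) (WQ κ u l u'))
    (hEs : ∀ κ u l u', WE κ u l u' = WE l u' κ u) (hJs : ∀ κ u l u', WJ κ u l u' = WJ l u' κ u)
    (hΛs : ∀ κ u l u', WΛ κ u l u' = WΛ l u' κ u) (hRs : ∀ κ u l u', WR κ u l u' = WR l u' κ u)
    (hQs : ∀ κ u l u', WQ κ u l u' = WQ l u' κ u)
    (X : Site 4 → MKer 4 (Fin 4)) {δX : ℝ} (hδX : 0 < δX) (hX : ∀ u, BiLoc (X u) u u Cx δX)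
    (hW1 : ∀ u, comp (comp (Ga n a) (divV (SbfBal n a cE cVH cΛ cR cK cQ) u)) (Ga n a)
      = comp (Ga n a) (X u) - comp (X u) (Ga n a))
    (hW2 : ∀ (u : Site 4) (l' : Fin 4) (u' : Site 4), divW (Wbf cE₂ cJ4 cΛ₂ cR₂ cQ₂ WE WJ WΛ WR WQ) u l' u'
      = comp (X u) (SbfBal n a cE cVH cΛ cR cK cQ l' u') - comp (SbfBal n a cE cVH cΛ cR cK cQ l' u') (X u))
    (μ ν : Fin 4) :
    B12Beta.secondMoment (TOfRed n a (SbfBal n a cE cVH cΛ cR cK cQ) (tableRed n (Wbf cE₂ cJ4 cΛ₂ cR₂ cQ₂ WE WJ WΛ WR WQ))) μ ν =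
      ∑ b ∈ (univ : Finset (Fin 4 → Fin n)).image resSite, ((n : ℝ) ^ 4)⁻¹ *
        fullSum (fun w : Pt => ((n : ℝ) ^ 8)⁻¹ * (toReal w μ * toReal w ν *
          baseKer (fineHess n a (SbfBal n a cE cVH cΛ cR cK cQ) (Wbf cE₂ cJ4 cΛ₂ cR₂ cQ₂ WE WJ WΛ WR WQ) μ ν) b w)) := by
  obtain ⟨Cs, δS, hδS, hS⟩ := exists_biLoc_SbfBal n a ha cE cVH cΛ cR cK cQ
  have hW := biLoc_Wbf (cE₂ := cE₂) (cJ4 := cJ4) (cΛ₂ := cΛ₂) (cR₂ := cR₂) (cQ₂ := cQ₂) hE hJ hΛ hR hQ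
  have hm : 0 < min (min δS δW) δX := lt_min (lt_min hδS hδW) hδX
  refine hF_SbfBal_of_divFree n a cE cVH cΛ cR cK cQ cE₂ cJ4 cΛ₂ cR₂ cQ₂ hn ha hGa hδW hE hJ hΛ hR hQ hEc hJc hΛc hRc hQc
    hEs hJs hΛs hRs hQs ?_ μ ν
  rw [← fineHessA_Ga]
  exact divFree_single_of_unitVec (divFree_fineHessA_of_wardLaws (Ga n a) X hGa
    (fun κ' u => biLoc_of_le (hS κ' u) ((min_le_left _ _).trans (min_le_left δS δW)))
    (fun κ' u l' u' => biLoc_of_le (hW κ' u l' u') ((min_le_left _ _).trans (min_le_right δS δW)))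
    (fun u => biLoc_of_le (hX u) (min_le_right _ _)) hm hW1 hW2)

end Bal

end Summit.QuantumFields.BalabanUV.Beta.D1BFx.FineHessianWardKroneckerBlock

end
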